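import Mathlib
import Summits.Ventures.DiscreteObjects.Mahler.BlaschkeDataReal

/-!
# The Mahler measure of a monic integer polynomial is an algebraic integer (venture `DiscreteObjects`, target L)

Cell `pub-namedobj`, seat `pub-namedobj-mahler` (gen 9). Framing: lottery ticket; floor = certified
bounds/negative ranges.

[McKee–Smyth, *Around the Unit Circle*, Prop. 1.9] (monic case): for a monic `P ∈ ℤ[X]`,
`M(P) = ∏_{|α|>1} |α| = |β|` with `β := ∏_{|α|>1} α`; the multiset of roots outside the unit circle is
closed under complex conjugation (`filter_roots_map_conj`), so `β̄ = β` is real, and `β` is a product of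
algebraic integers.  Hence `M(P) = ±β` is an algebraic integer (`IsIntegral ℤ`).  Used in
`SmythIsolationStrict` to make the gap in Smyth's theorem strict (`M(P) ≠ √((93+√2249)/80)`, which is
not an algebraic integer).

* `intMahlerMeasure_eq_norm_prod_roots` — `M(P) = ‖∏_{‖α‖>1} α‖` for monic `P`;
* `isIntegral_intMahlerMeasure_of_monic` — **`M(P)` is an algebraic integer** for monic `P ∈ ℤ[X]`.
-/

namespace Summit.Ventures.DiscreteObjects.Mahler

open Polynomial
open scoped ComplexConjugate

/-- `(S.map max(1,‖·‖)).prod = ‖(S.filter (‖·‖ > 1)).prod‖` for a multiset of complex numbers. -/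
theorem prod_map_max_one_norm (S : Multiset ℂ) :
    (S.map fun a => max 1 ‖a‖).prod = ‖(S.filter fun a => ¬ ‖a‖ ≤ 1).prod‖ := by
  induction S using Multiset.induction_on with
  | empty => simp
  | cons a S ih =>
    rw [Multiset.map_cons, Multiset.prod_cons, ih, Multiset.filter_cons]
    by_cases h : ‖a‖ ≤ 1
    · rw [max_eq_left h, one_mul, if_neg (not_not.mpr h), zero_add]
    · rw [max_eq_right (not_le.mp h).le, if_pos h, Multiset.singleton_add, Multiset.prod_cons, norm_mul]

/-- **`M(P) = ‖∏_{‖α‖>1} α‖`** for a monic integer polynomial (product over the complex roots outside the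
closed unit disc, with multiplicity). -/
theorem intMahlerMeasure_eq_norm_prod_roots {P : ℤ[X]} (hmonic : P.Monic) :
    intMahlerMeasure P = ‖(((P.map (Int.castRingHom ℂ)).roots).filter fun a => ¬ ‖a‖ ≤ 1).prod‖ := by
  unfold intMahlerMeasure
  rw [mahlerMeasure_eq_leadingCoeff_mul_prod_roots, (hmonic.map _).leadingCoeff, norm_one, one_mul,
    prod_map_max_one_norm]

/-- The product of the roots outside the unit circle is real (the multiset is conjugation-closed). -/
theorem conj_prod_roots_outside (P : ℤ[X]) :
    conj ((((P.map (Int.castRingHom ℂ)).roots).filter fun a => ¬ ‖a‖ ≤ 1).prod) =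
      (((P.map (Int.castRingHom ℂ)).roots).filter fun a => ¬ ‖a‖ ≤ 1).prod := by
  rw [map_multiset_prod]
  congr 1
  exact filter_roots_map_conj P _ (fun α => by rw [Complex.norm_conj])

/-- Every complex root of a monic integer polynomial is an algebraic integer. -/
theorem isIntegral_of_mem_roots {P : ℤ[X]} (hmonic : P.Monic) {α : ℂ}
    (hα : α ∈ (P.map (Int.castRingHom ℂ)).roots) : IsIntegral ℤ α := by
  have h0 : P.map (Int.castRingHom ℂ) ≠ 0 := (hmonic.map _).ne_zero
  have hroot := (mem_roots h0).mp hα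
  refine ⟨P, hmonic, ?_⟩
  rw [IsRoot.def, eval_map] at hroot
  rwa [algebraMap_int_eq]

/-- **[McKee–Smyth, Prop. 1.9], monic case: `M(P)` is an algebraic integer** for a monic `P ∈ ℤ[X]`. -/
theorem isIntegral_intMahlerMeasure_of_monic {P : ℤ[X]} (hmonic : P.Monic) :
    IsIntegral ℤ (intMahlerMeasure P) := by
  set S₂ := ((P.map (Int.castRingHom ℂ)).roots).filter fun a => ¬ ‖a‖ ≤ 1 with hS₂
  set β : ℂ := S₂.prod with hβ
  have hβint : IsIntegral ℤ β := by
    apply IsIntegral.multiset_prod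
    intro x hx
    exact isIntegral_of_mem_roots hmonic (Multiset.mem_of_mem_filter hx)
  -- `β` is real
  have hβreal : ((β.re : ℝ) : ℂ) = β := Complex.conj_eq_iff_re.mp (conj_prod_roots_outside P)
  have hre : IsIntegral ℤ β.re := by
    rw [← hβreal] at hβint
    exact (isIntegral_algebraMap_iff (A := ℝ) (B := ℂ) (algebraMap ℝ ℂ).injective).mp hβint
  have hM : intMahlerMeasure P = |β.re| := by
    rw [intMahlerMeasure_eq_norm_prod_roots hmonic, ← hβ]
    conv_lhs => rw [← hβreal]
    rw [Complex.norm_real, Real.norm_eq_abs]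
  rw [hM]
  rcases abs_choice β.re with h | h
  · rw [h]; exact hre
  · rw [h]; exact hre.neg

end Summit.Ventures.DiscreteObjects.Mahler
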